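import Summits.BirchSwinnertonDyer.BirchSwinnertonDyer.Theses.ToricShedding
import Literature.NumberTheory.EllipticCurves.BSDSelmerParityDokchitserBaseChangeProofs
import HarnessLib

/-!
# Line `birth` — birth skeleton for crux `BipartiteToricBound` (stmt-BirchSwinnertonDyer-16085)

Crux (route ToricShedding, rank 9, literature leaf, XL): **a non-zero toric period of a level-raised
mod-`p^M` quaternionic eigenform at `ν(n)` admissible primes bounds
`corank_{ℤ_p} Sel_{p^∞}(E/ℚ) + corank_{ℤ_p} Sel_{p^∞}(E^{d_K}/ℚ) ≤ ν(n)`** — C.-H. Kim, *A higher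
Gross–Zagier formula and the structure of Selmer groups*, TAMS 2024 = arXiv:2203.12161, Thm 5.18 /
5.23 over Howard 2006 (bipartite Euler systems), Bertolini–Darmon 2005 (level raising, reciprocity
laws), Chida–Hsieh (the classes), composed with Dokchitser–Dokchitser 2010 Lem. 4.14 (the PROVED
tree theorem `selmerCorank_baseChange_quadratic_holds`).

## The cut (planner skeleton registrar, 2026-08-17)

The printed proof (Kim2024 §5.1.4 and proof of Thm 5.23, pp. 12–13 of the arXiv text, read
2026-08-17) passes through the FINITE-LEVEL Selmer group `Sel^{(p^M)}(E/K) = Sel_{𝓕_cl}(K, E[p^M])`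
and only then to `ℤ_p`-coranks.  The skeleton cuts exactly there, one level BELOW the vendored
corank-form fact `Literature.NumberTheory.EllipticCurves.kim_selmerCorank_baseChange_le_of_toricPeriod_ne_zero`
(which is Thm 5.23 read on coranks and is one `rw` away from the crux — so it is NOT a stub here):

* stub **KIM** `stub_kimModPMStructure` (XL, the theorem in print at level `M`): in the crux's
  data and under its side conditions, a toric period `λ_n ≢ 0 (mod p^M)` forces
  **`Sel^{(p^M)}(E/K)` contains no subgroup `≅ (ℤ/p^M)^{ν(n)+1}`** — Kim2024 Thm 5.18 for the free
  bipartite Euler system `λ^{bip,(M)}` on `2M`-admissible `n` (proof of Thm 5.23, "`j ≥ 2k`"):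
  `∂^{(ν(n))}(λ^{bip,(M)}) ≤ ind(λ_n) < M` gives `δ + Σ_{i ≥ ν(n)/2+1} d_i < M` for
  `Sel_{𝓕_cl}(K, E[p^M]) ≅ ⊕_i (ℤ/p^{d_i})^{⊕2}`, so at most `ν(n)/2` PAIRS of elementary divisors
  equal `p^M`, i.e. `dim_{𝔽_p} p^{M-1} Sel^{(p^M)}(E/K) ≤ ν(n)`; inputs Thm 5.21 (weak level
  raising, BertoliniDarmon2005 / ChidaHsieh2014), §5.2.3–5.2.4 (`λ^bip`, `κ^bip`), the two explicit
  reciprocity laws, Howard2006 §§2–3 (freeness, Props 5.5/5.7, Thms 5.16–5.17).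
* stub **DIV** `stub_divisibleCore` (M-sized, `p`-primary group theory + weak Mordell–Weil): for
  every elliptic curve `V` over a number field `K`, prime `p` and `M`,
  **`(ℤ/p^M)^{corank_{ℤ_p} Sel_{p^∞}(V/K)} ↪ Sel_{p^∞}(V/K)`** — the tree's corank is the formula
  `dim A[p] − dim A/pA` (`Literature.NumberTheory.EllipticCurves.zpCorank`); for the cofinitely
  generated `p`-primary group `A = Sel_{p^∞}(V/K)` (`A[p]` finite: `finite_torsionBy_selmerGroupPInfty`)
  its divisible part `p^k A` (`k` a stability index) is `p`-divisible with `#(p^k A)[p] = p^{corank}`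
  (`pow_zpCorank_eq_natCard_torsionBy_inf_range_of_stable`), and a `p`-divisible `p`-primary group
  whose `p`-torsion has `𝔽_p`-dimension `r` contains `(ℤ/p^M)^r` for every `M` (Greenberg LNM 1716 §1).
* stub **LIFT** `stub_kummerLevelLift` (M-sized, Galois cohomology): for every elliptic curve `V`
  over a number field `K`, prime `p`, `M` and `s`, **every subgroup `≅ (ℤ/p^M)^s` of `Sel_{p^∞}(V/K)`
  lifts to a subgroup `≅ (ℤ/p^M)^s` of `Sel^{(p^M)}(V/K)`** — the long exact cohomology sequence of
  `0 → E[p^M] → E[p^∞] —p^M→ E[p^∞] → 0` makes `H¹(K, E[p^M]) → H¹(K, E[p^∞])[p^M]` surjective; with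
  the tree's definition of both Selmer groups as kernels towards `∏_v H¹(K_v, E)` ANY lift of a
  Selmer class is Selmer (functoriality of `ContinuousCohomology.map` along `E[p^M] ↪ E[p^∞] ↪ E`);
  lifts of a `ℤ/p^M`-independent family stay independent (Milne ADT I.§6; Greenberg 1999 §2).

`BipartiteToricBound_of (hKim : Statement.stub_kimModPMStructure) (hDiv : Statement.stub_divisibleCore)
(hLift : Statement.stub_kummerLevelLift) : ToricShedding.BipartiteToricBound` (sorry-free; stub
statements BY NAME via `type_of%` abbrevs; `BipartiteToricBound_proof` plugs the sorried stubs in):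
with `r := corank_{ℤ_p} Sel_{p^∞}(E/K)`, DIV embeds `(ℤ/p^M)^r` in `Sel_{p^∞}(E/K)`, LIFT moves it
into `Sel^{(p^M)}(E/K)`, KIM gives `r ≤ ν(n)`, and the proved tree theorem
`selmerCorank_baseChange_quadratic_holds` (`[K:ℚ] = 2` is a conjunct of the hypotheses) rewrites
`r = corank(E/ℚ) + corank(E^{d_K}/ℚ)`.  The three stubs have pairwise disjoint tool-kits
(automorphic / bipartite Euler systems; `p`-primary abelian groups; cohomological exact sequences);
none is the crux or the summit reworded, none is a tree one-liner (BC3 probes below).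

Disproof used: none on file (`ledger crux ls stmt-BirchSwinnertonDyer-16085`: no workfiles,
2026-08-17).  Negatives index (`ledger negatives --problem BirchSwinnertonDyer`, 2026-08-17): no
entry concerns `selmerGroup` / `selmerGroupPInfty` / toric periods; no stub is an instance of a
refuted statement.  Item notes honoured: grounder g50-3/g50-4 (Kim2024 pp. 10–13 read; the
corank-form fact vendored in `Literature/NumberTheory/EllipticCurves/BipartiteToricPeriod.lean`,
item = fact ∘ DD2010) — this skeleton refines the fact, it does not restate it; refuter rreview
(d_K odd is §2.7-only, no repair needed) — nothing in the stubs depends on the parity of `d_K`.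

BC3 probes (planner folder `bc/probe*_<stub>.lean`, farm `lean check`, 2026-08-17; probe imports =
these imports + the vendored fact file `BipartiteToricPeriod`): for each stub,
`Stub → BipartiteToricBound` and `Stub → BirchSwinnertonDyer` by
`first | exact? | simpa [Stub] | (unfold Stub; simpa) | aesop` FAIL, the unfolded/intro'd variants
FAIL, the tactics one at a time (`exact?` at 10⁶ heartbeats, `aesop`, `simpa using h`) FAIL, and
`Stub` itself by `first | exact? | simp | aesop` FAILS — 35/35 probes fail; verbatim outcomes in
`Lines/birth.md`.
-/

set_option linter.dupNamespace false

namespace Summit.BirchSwinnertonDyer.BirchSwinnertonDyer.Cruxes.BipartiteToricBound.Birth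

open scoped BigOperators

open Summit.BirchSwinnertonDyer.BirchSwinnertonDyer.Theses.ToricShedding (BipartiteToricBound)

/-! ### Registered stubs -/

/-- Stub **KIM** (the theorem in print, finite level `M`; XL to formalise): in the data of the crux
(`W` global minimal, `p ≥ 5` good ordinary with `ρ̄_{E,p}` surjective and `p ∤ q² - 1` for `q ∣ N`,
`K` imaginary quadratic with `d_K < -4`, `(d_K, Np) = 1`, `N = N⁺N⁻` split/inert, `N⁻` square-free
with `ν(N⁻)` odd, `n` square-free `2M`-admissible, `B = (a,b)_ℚ` definite ramified exactly at
`N⁻n`, `O` Eichler of level `N⁺`, `RI` the invertible right `O`-ideals, `φ : RI → ℤ/p^M` an anemic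
Hecke eigenfunction with the eigenvalues `a_q(E)`, primitive and alone on its eigenline, `(ψ, I, rep)`
a conductor-`1` Gross point with ideal-class representatives) a toric period
`Σ_{[𝔞] ∈ Cl_K} φ(ψ(rep 𝔞)·I) ≠ 0` in `ℤ/p^M` forces: every subgroup of the `p^M`-Selmer group
`Sel^{(p^M)}(E/K)` (`WeierstrassCurve.selmerGroup` of the base change `W_K` at `p^M`) isomorphic to
`(ℤ/p^M)^s` has `s ≤ ν(n)`.  Kim2024 Thm 5.18 applied, as in the proof of Thm 5.23, to the free
bipartite Euler system `(λ^{bip,(M)}, κ^{bip,(M)})` on `2M`-admissible `n` (Thm 5.21, §5.2.3–5.2.4,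
Howard2006): `∂^{(ν(n))} ≤ ind(λ_n) < M ⇒ Σ_{i ≥ ν(n)/2+1} d_i < M` for
`Sel_{𝓕_cl}(K, E[p^M]) ≅ ⊕_i (ℤ/p^{d_i})^{⊕2}`, so at most `ν(n)` elementary divisors equal `p^M`.
[cite: Kim2024, Thm 5.18 and proof of Thm 5.23] -/
theorem stub_kimModPMStructure :
    ∀ (W : WeierstrassCurve ℚ) [W.IsElliptic] [W.IsGloballyMinimal] (p : ℕ) [Fact p.Prime] (M
      Nplus Nminus n : ℕ) (a b : ℚ) (O : Subring (QuaternionAlgebra ℚ a 0 b)) (K : Type) [Field K]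
      [NumberField K] (ψ : K →ₐ[ℚ] QuaternionAlgebra ℚ a 0 b) (I : Submodule ℤ (QuaternionAlgebra ℚ
      a 0 b)) (φ : Submodule ℤ (QuaternionAlgebra ℚ a 0 b) → ZMod (p ^ M)) (rep : ClassGroup
      (NumberField.RingOfIntegers K) → nonZeroDivisors (Ideal (NumberField.RingOfIntegers K))) (RI :
      Set (Submodule ℤ (QuaternionAlgebra ℚ a 0 b))) (IsEig : (Submodule ℤ (QuaternionAlgebra ℚ a 0
      b) → ZMod (p ^ M)) → Prop), ((5 ≤ p ∧ 1 ≤ M ∧ W.HasGoodReductionAtPrime p ∧ ¬ (p : ℤ) ∣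
      W.frobeniusTrace p ∧ W.HasSurjectiveModNGaloisRep p ∧ (∀ q : ℕ, q.Prime → q ∣ W.conductorNorm
      ℤ → ¬ (p : ℤ) ∣ (q : ℤ) ^ 2 - 1)) ∧ (Module.finrank ℚ K = 2 ∧ NumberField.IsTotallyComplex K ∧
      NumberField.discr K < -4 ∧ Int.gcd (NumberField.discr K) (W.conductorNorm ℤ * p) = 1) ∧
      (W.conductorNorm ℤ = Nplus * Nminus ∧ Nat.Coprime Nplus Nminus ∧ Squarefree Nminus ∧ Odd
      Nminus.primeFactors.card ∧ (∀ q : ℕ, q.Prime → q ∣ Nplus → ((Ideal.span {(q : ℤ)}).primesOver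
      (NumberField.RingOfIntegers K)).ncard = 2) ∧ (∀ q : ℕ, q.Prime → q ∣ Nminus * n → ((Ideal.span
      {(q : ℤ)}).primesOver (NumberField.RingOfIntegers K)).ncard = 1)) ∧ (Squarefree n ∧
      Nat.Coprime n (W.conductorNorm ℤ * p) ∧ Int.gcd (NumberField.discr K) n = 1 ∧ (∀ ℓ : ℕ,
      ℓ.Prime → ℓ ∣ n → ¬ (p : ℤ) ∣ (ℓ : ℤ) ^ 2 - 1 ∧ ((p : ℤ) ^ (2 * M) ∣ W.frobeniusTrace ℓ - (ℓ +
      1) ∨ (p : ℤ) ^ (2 * M) ∣ W.frobeniusTrace ℓ + (ℓ + 1)))) ∧ (a < 0 ∧ b < 0 ∧ (∀ (q : ℕ) [Fact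
      q.Prime], (∀ x : QuaternionAlgebra ℚ_[q] (a : ℚ_[q]) 0 (b : ℚ_[q]), x ≠ 0 → IsUnit x) ↔ q ∣
      Nminus * n)) ∧ (∃ O₁ O₂ : Subring (QuaternionAlgebra ℚ a 0 b), (∀ S : Subring
      (QuaternionAlgebra ℚ a 0 b), (S = O₁ ∨ S = O₂) → (S.toAddSubgroup.FG ∧ (∀ d :
      QuaternionAlgebra ℚ a 0 b, ∃ m : ℤ, m ≠ 0 ∧ m • d ∈ S) ∧ ∀ S' : Subring (QuaternionAlgebra ℚ a
      0 b), S'.toAddSubgroup.FG → S ≤ S' → S' = S)) ∧ O = O₁ ⊓ O₂ ∧ O.toAddSubgroup.relIndex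
      O₁.toAddSubgroup = Nplus) ∧ ((∀ J : Submodule ℤ (QuaternionAlgebra ℚ a 0 b), J ∈ RI ↔ (J.FG ∧
      (∀ d : QuaternionAlgebra ℚ a 0 b, ∃ m : ℤ, m ≠ 0 ∧ m • d ∈ J) ∧ (∀ x : QuaternionAlgebra ℚ a 0
      b, (∀ y ∈ J, y * x ∈ J) ↔ x ∈ O) ∧ (∃ J' : Submodule ℤ (QuaternionAlgebra ℚ a 0 b), (∀ x :
      QuaternionAlgebra ℚ a 0 b, x ∈ J * J' ↔ ∀ y ∈ J, x * y ∈ J) ∧ (∀ x : QuaternionAlgebra ℚ a 0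
      b, x ∈ J' * J ↔ x ∈ O)))) ∧ (∀ g : Submodule ℤ (QuaternionAlgebra ℚ a 0 b) → ZMod (p ^ M),
      IsEig g ↔ ((∀ J ∈ RI, ∀ β : QuaternionAlgebra ℚ a 0 b, IsUnit β → g (J.map
      (AddMonoidHom.mulLeft β).toIntLinearMap) = g J) ∧ (∀ q : ℕ, q.Prime → ¬ q ∣ W.conductorNorm ℤ
      * n → ∀ J ∈ RI, ∑ᶠ J' ∈ {J' : Submodule ℤ (QuaternionAlgebra ℚ a 0 b) | J' ≤ J ∧
      J'.toAddSubgroup.relIndex J.toAddSubgroup = q ^ 2 ∧ ∀ y ∈ J', ∀ x ∈ O, y * x ∈ J'}, g J' =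
      ((W.frobeniusTrace q : ℤ) : ZMod (p ^ M)) * g J))) ∧ IsEig φ ∧ (∃ J ∈ RI, IsUnit (φ J)) ∧ (∀ g
      : Submodule ℤ (QuaternionAlgebra ℚ a 0 b) → ZMod (p ^ M), IsEig g → ∃ u : ZMod (p ^ M), ∀ J ∈
      RI, g J = u * φ J)) ∧ (I ∈ RI ∧ (∀ x : NumberField.RingOfIntegers K, ∀ y ∈ I, ψ (x : K) * y ∈
      I) ∧ (∀ x : K, (∀ y ∈ I, ψ x * y ∈ I) → ∃ z : NumberField.RingOfIntegers K, (z : K) = x) ∧ (∀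
      𝔞 : ClassGroup (NumberField.RingOfIntegers K), ClassGroup.mk0 (rep 𝔞) = 𝔞))) → (∑ 𝔞 :
      ClassGroup (NumberField.RingOfIntegers K), φ (Submodule.span ℤ ((fun x :
      NumberField.RingOfIntegers K => ψ (x : K)) '' ((rep 𝔞 : nonZeroDivisors (Ideal
      (NumberField.RingOfIntegers K))) : Ideal (NumberField.RingOfIntegers K))) * I)) ≠ 0 → ∀ s : ℕ,
      (∃ f : (Fin s → ZMod (p ^ M)) →+ ↥((W.baseChange K).selmerGroup ((p : ℤ) ^ M)),
      Function.Injective f) → s ≤ n.primeFactors.card := by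
  sorry

/-- Stub **DIV** (the divisible core of the `p^∞`-Selmer group at level `p^M`): for an elliptic
curve `V` over a number field `K`, a prime `p` and `M : ℕ`, the `p^∞`-Selmer group `Sel_{p^∞}(V/K)`
contains a subgroup isomorphic to `(ℤ/p^M)^r`, `r = corank_{ℤ_p} Sel_{p^∞}(V/K)` (the tree's
`selmerCorank`, i.e. the formula `dim_{𝔽_p} A[p] - dim_{𝔽_p} A/pA`).  `A = Sel_{p^∞}(V/K)` is
`p`-primary with `A[p]` finite, hence `A ≅ (ℚ_p/ℤ_p)^r ⊕ (finite)`; in the tree's idiom: the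
divisible part `p^k A` is `p`-divisible with `#(p^k A)[p] = p^r`
(`pow_zpCorank_eq_natCard_torsionBy_inf_range_of_stable`), and a `p`-divisible `p`-primary group
with `p`-torsion of dimension `r` contains `(ℤ/p^M)^r`. [cite: Greenberg1999, §1–2] -/
theorem stub_divisibleCore :
    ∀ (K : Type) [Field K] [NumberField K] (V : WeierstrassCurve K) [V.IsElliptic] (p : ℕ)
      [Fact p.Prime] (M : ℕ),
      ∃ f : (Fin (V.selmerCorank p) → ZMod (p ^ M)) →+ ↥(V.selmerGroupPInfty p),
        Function.Injective f := by
  sorry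

/-- Stub **LIFT** (free `ℤ/p^M`-submodules lift from `Sel_{p^∞}` to the `p^M`-Selmer group): for
an elliptic curve `V` over a number field `K`, a prime `p` and `M s : ℕ`, if `Sel_{p^∞}(V/K)`
contains a subgroup isomorphic to `(ℤ/p^M)^s` then so does `Sel^{(p^M)}(V/K)`.  From the long
exact sequence of `0 → E[p^M] → E[p^∞] → E[p^∞] → 0` (`p^M` is onto on `E(K̄)[p^∞]`, `E(K̄)`
divisible): `H¹(K, E[p^M]) → H¹(K, E[p^∞])[p^M]` is surjective; any lift of a class of
`Sel_{p^∞}(V/K)` lies in `Sel^{(p^M)}(V/K)` because both are the kernels towards `∏_v H¹(K_v, E)`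
(tree definitions `selmerGroup`, `selmerGroupPInfty`) and the composite
`H¹(K, E[p^M]) → H¹(K, E[p^∞]) → H¹(K_v, E)` is the direct map; lifts of a `ℤ/p^M`-independent
family are independent. [cite: Greenberg1999, §2] -/
theorem stub_kummerLevelLift :
    ∀ (K : Type) [Field K] [NumberField K] (V : WeierstrassCurve K) [V.IsElliptic] (p : ℕ)
      [Fact p.Prime] (M s : ℕ),
      (∃ f : (Fin s → ZMod (p ^ M)) →+ ↥(V.selmerGroupPInfty p), Function.Injective f) →
        ∃ g : (Fin s → ZMod (p ^ M)) →+ ↥(V.selmerGroup ((p : ℤ) ^ M)), Function.Injective g := by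
  sorry

/-! ### Stub statements by name

The skeleton gate (`#h21_check_skeleton`) reads the composition's hypotheses BY NAME: each must be
a declared stub. The `abbrev`s below are the stubs' exact elaborated types (`type_of%`), so
`BipartiteToricBound_of` takes `(h : Statement.stub_<name>)` and nothing else. -/

namespace Statement

/-- Statement of `stub_kimModPMStructure`. -/
abbrev stub_kimModPMStructure : Prop := type_of% @Birth.stub_kimModPMStructure
/-- Statement of `stub_divisibleCore`. -/
abbrev stub_divisibleCore : Prop := type_of% @Birth.stub_divisibleCore
/-- Statement of `stub_kummerLevelLift`. -/
abbrev stub_kummerLevelLift : Prop := type_of% @Birth.stub_kummerLevelLift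

end Statement

/-! ### The crux from the stubs (kernel-checked composition, no `sorry`) -/

/-- **The crux BY NAME from the three stub statements** (KIM → DIV → LIFT →
`ToricShedding.BipartiteToricBound`): with `r = corank_{ℤ_p} Sel_{p^∞}(E/K)`, DIV embeds
`(ℤ/p^M)^r` in `Sel_{p^∞}(E/K)`, LIFT moves the copy into `Sel^{(p^M)}(E/K)`, KIM bounds `r ≤ ν(n)`,
and Dokchitser–Dokchitser's Lemma 4.14 (the proved tree theorem
`selmerCorank_baseChange_quadratic_holds`, `[K : ℚ] = 2` being a conjunct of the hypotheses)
rewrites `r = corank(E/ℚ) + corank(E^{d_K}/ℚ)`. [cite: Kim2024, proof of Thm 5.23] -/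
theorem BipartiteToricBound_of (hKim : Statement.stub_kimModPMStructure)
    (hDiv : Statement.stub_divisibleCore) (hLift : Statement.stub_kummerLevelLift) :
    BipartiteToricBound := by
  intro W _ _ p _ M Nplus Nminus n a b O K _ _ ψ I φ rep RI IsEig hyp hper
  have hK : Module.finrank ℚ K = 2 := hyp.2.1.1
  obtain ⟨f, hf⟩ := hDiv K (W.baseChange K) p M
  obtain ⟨g, hg⟩ := hLift K (W.baseChange K) p M ((W.baseChange K).selmerCorank p) ⟨f, hf⟩
  have hle : (W.baseChange K).selmerCorank p ≤ n.primeFactors.card :=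
    hKim W p M Nplus Nminus n a b O K ψ I φ rep RI IsEig hyp hper _ ⟨g, hg⟩
  rw [Literature.NumberTheory.EllipticCurves.selmerCorank_baseChange_quadratic_holds W K hK p] at hle
  exact hle

/-- The crux along this line, MODULO exactly the three registered stubs (depends on `sorryAx` only
through `stub_*`). [cite: Kim2024, Thm 5.23] -/
theorem BipartiteToricBound_proof : BipartiteToricBound :=
  BipartiteToricBound_of stub_kimModPMStructure stub_divisibleCore stub_kummerLevelLift

end Summit.BirchSwinnertonDyer.BirchSwinnertonDyer.Cruxes.BipartiteToricBound.Birth
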